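import Mathlib
import Literature.Geometry.DiscreteGeometry.CrystallographicGroups
import Summits.AtomisticToContinuum.Crystallization.Theorems.IsometryAtomsMinimisingLawsCohesiveGroupStructureAux1
import Summits.AtomisticToContinuum.Crystallization.Theorems.IsometryAtomsMinimisingLawsCohesiveGroupStructureAux3

/-!
# Discontinuous groups of isometries of `ℝ³`, part 4: small rotations and commutator sequences

Helper file for stub `stub_groupStructure` (F) of line `purity_stacking` of the crux
`IsometryAtoms.MinimisingLawsCohesive` (stmt-AtomisticToContinuum-15777). The Bieberbach engine:

* the DEVIATION `‖L - 1‖` (operator norm) of a linear isometry controls `‖L x - x‖`, vanishes only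
  at `L = 1`, and contracts under commutators: `‖[A,B] - 1‖ ≤ 2 ‖A - 1‖ ‖B - 1‖`;
* if `Γ` has infinitely many linear parts, it contains an element whose linear part is a
  determinant-one isometry `≠ 1` with deviation as small as we please (pigeonhole in the compact
  group `O(3)`, then square);
* for `g ∈ Γ` with small linear part commuting with the translations of `Γ`, and any `h ∈ Γ`, the
  commutator sequence `k₀ = h`, `k_{j+1} = g k_j g⁻¹ k_j⁻¹` reaches `1`: its translation parts stay
  bounded, so by discontinuity it repeats, and a repetition forces a vanishing deviation; with a
  downward-induction principle along the sequence.
-/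

noncomputable section

open scoped RealInnerProductSpace
open Literature.Geometry.DiscreteGeometry.Crystallographic Module

namespace Summit.AtomisticToContinuum.Crystallization.Theorems.IsometryAtomsMinimisingLawsCohesive.GroupStructure

/-! ## Deviation of a linear isometry from the identity -/

/-- `‖L x - x‖ ≤ ‖L - 1‖ ‖x‖` (operator norm of the deviation). -/
theorem norm_sub_le_dev (L : EuclideanSpace ℝ (Fin 3) ≃ₗᵢ[ℝ] EuclideanSpace ℝ (Fin 3)) (x : EuclideanSpace ℝ (Fin 3)) :
    ‖L x - x‖ ≤ ‖(L.toContinuousLinearEquiv : EuclideanSpace ℝ (Fin 3) →L[ℝ] EuclideanSpace ℝ (Fin 3)) - 1‖ * ‖x‖ := by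
  have h := ((L.toContinuousLinearEquiv : EuclideanSpace ℝ (Fin 3) →L[ℝ] EuclideanSpace ℝ (Fin 3)) - 1).le_opNorm x
  simpa using h

/-- A pointwise bound `‖L x - x‖ ≤ c ‖x‖` (`c ≥ 0`) bounds the deviation. -/
theorem dev_le_of_bound (L : EuclideanSpace ℝ (Fin 3) ≃ₗᵢ[ℝ] EuclideanSpace ℝ (Fin 3)) {c : ℝ} (hc : 0 ≤ c)
    (h : ∀ x, ‖L x - x‖ ≤ c * ‖x‖) :
    ‖(L.toContinuousLinearEquiv : EuclideanSpace ℝ (Fin 3) →L[ℝ] EuclideanSpace ℝ (Fin 3)) - 1‖ ≤ c := by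
  refine ContinuousLinearMap.opNorm_le_bound _ hc fun x => ?_
  simpa using h x

/-- Vanishing deviation means `L = 1`. -/
theorem eq_one_of_dev_eq_zero (L : EuclideanSpace ℝ (Fin 3) ≃ₗᵢ[ℝ] EuclideanSpace ℝ (Fin 3))
    (h : ‖(L.toContinuousLinearEquiv : EuclideanSpace ℝ (Fin 3) →L[ℝ] EuclideanSpace ℝ (Fin 3)) - 1‖ = 0) : L = 1 := by
  ext x : 1
  have hx := norm_sub_le_dev L x
  rw [h, zero_mul] at hx
  have : L x - x = 0 := norm_eq_zero.1 (le_antisymm hx (norm_nonneg _))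
  simpa [sub_eq_zero] using this

/-- Every linear isometry has deviation at most `2`. -/
theorem dev_le_two (L : EuclideanSpace ℝ (Fin 3) ≃ₗᵢ[ℝ] EuclideanSpace ℝ (Fin 3)) :
    ‖(L.toContinuousLinearEquiv : EuclideanSpace ℝ (Fin 3) →L[ℝ] EuclideanSpace ℝ (Fin 3)) - 1‖ ≤ 2 := by
  refine dev_le_of_bound L (by norm_num) fun x => ?_
  calc ‖L x - x‖ ≤ ‖L x‖ + ‖x‖ := norm_sub_le _ _
    _ = 2 * ‖x‖ := by rw [L.norm_map]; ring

/-- **Commutator contraction of deviations**: `‖[A,B] - 1‖ ≤ 2 ‖A - 1‖ ‖B - 1‖`. -/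
theorem dev_commutator_le (A B : EuclideanSpace ℝ (Fin 3) ≃ₗᵢ[ℝ] EuclideanSpace ℝ (Fin 3)) :
    ‖((A * B * A⁻¹ * B⁻¹).toContinuousLinearEquiv : EuclideanSpace ℝ (Fin 3) →L[ℝ] EuclideanSpace ℝ (Fin 3)) - 1‖ ≤
      2 * ‖(A.toContinuousLinearEquiv : EuclideanSpace ℝ (Fin 3) →L[ℝ] EuclideanSpace ℝ (Fin 3)) - 1‖ *
        ‖(B.toContinuousLinearEquiv : EuclideanSpace ℝ (Fin 3) →L[ℝ] EuclideanSpace ℝ (Fin 3)) - 1‖ := by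
  refine dev_le_of_bound _ (by positivity) fun x => ?_
  exact small_commutator (norm_nonneg _) (norm_nonneg _) (norm_sub_le_dev A) (norm_sub_le_dev B) x

/-- Deviation of a square: `‖A² - 1‖ ≤ 2 ‖A - 1‖`. -/
theorem dev_mul_self_le (A : EuclideanSpace ℝ (Fin 3) ≃ₗᵢ[ℝ] EuclideanSpace ℝ (Fin 3)) :
    ‖((A * A).toContinuousLinearEquiv : EuclideanSpace ℝ (Fin 3) →L[ℝ] EuclideanSpace ℝ (Fin 3)) - 1‖ ≤
      2 * ‖(A.toContinuousLinearEquiv : EuclideanSpace ℝ (Fin 3) →L[ℝ] EuclideanSpace ℝ (Fin 3)) - 1‖ := by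
  refine dev_le_of_bound _ (by positivity) fun x => ?_
  have h1 := norm_sub_le_dev A x
  have h2 := norm_sub_le_dev A (A x)
  rw [A.norm_map] at h2
  calc ‖(A * A) x - x‖ = ‖(A (A x) - A x) + (A x - x)‖ := by
        congr 1; change A (A x) - x = _; abel
    _ ≤ ‖A (A x) - A x‖ + ‖A x - x‖ := norm_add_le _ _
    _ ≤ _ := by linarith

/-! ## A small nontrivial rotation from infinitely many linear parts -/

/-- **Pigeonhole in `O(3)`**: if the set of linear parts of `Γ` is infinite then for every
`η > 0` there is `g ∈ Γ` whose linear part is `≠ 1` and has deviation `< η`. -/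
theorem exists_lin_ne_one_dev_lt {Γ : Subgroup (EuclideanSpace ℝ (Fin 3) ≃ᵢ EuclideanSpace ℝ (Fin 3))}
    (hinf : ((fun g : EuclideanSpace ℝ (Fin 3) ≃ᵢ EuclideanSpace ℝ (Fin 3) => g.toRealLinearIsometryEquiv) ''
      (Γ : Set (EuclideanSpace ℝ (Fin 3) ≃ᵢ EuclideanSpace ℝ (Fin 3)))).Infinite)
    {η : ℝ} (hη : 0 < η) :
    ∃ g ∈ Γ, g.toRealLinearIsometryEquiv ≠ 1 ∧
      ‖(g.toRealLinearIsometryEquiv.toContinuousLinearEquiv : EuclideanSpace ℝ (Fin 3) →L[ℝ] EuclideanSpace ℝ (Fin 3)) - 1‖ < η := by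
  -- the linear parts, seen as continuous linear maps, lie in the compact unit ball
  set φ : (EuclideanSpace ℝ (Fin 3) ≃ₗᵢ[ℝ] EuclideanSpace ℝ (Fin 3)) → (EuclideanSpace ℝ (Fin 3) →L[ℝ] EuclideanSpace ℝ (Fin 3)) :=
    fun L => (L.toContinuousLinearEquiv : EuclideanSpace ℝ (Fin 3) →L[ℝ] EuclideanSpace ℝ (Fin 3)) with hφ
  have hφinj : Function.Injective φ := by
    intro L L' h
    ext x : 1
    have := congrArg (fun f : EuclideanSpace ℝ (Fin 3) →L[ℝ] EuclideanSpace ℝ (Fin 3) => f x) h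
    simpa [hφ] using this
  have hball : ∀ L, φ L ∈ Metric.closedBall (0 : EuclideanSpace ℝ (Fin 3) →L[ℝ] EuclideanSpace ℝ (Fin 3)) 1 := by
    intro L
    rw [mem_closedBall_zero_iff]
    refine ContinuousLinearMap.opNorm_le_bound _ zero_le_one fun x => ?_
    simp [hφ]
  have htb : TotallyBounded (Metric.closedBall (0 : EuclideanSpace ℝ (Fin 3) →L[ℝ] EuclideanSpace ℝ (Fin 3)) 1) :=
    (isCompact_closedBall _ _).totallyBounded
  obtain ⟨t, htfin, hcover⟩ := Metric.totallyBounded_iff.1 htb (η / 2) (by linarith)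
  -- choose a centre for each linear part
  have hcentre : ∀ L : EuclideanSpace ℝ (Fin 3) ≃ₗᵢ[ℝ] EuclideanSpace ℝ (Fin 3), ∃ y ∈ t, dist (φ L) y < η / 2 := by
    intro L
    have := hcover (hball L)
    simp only [Set.mem_iUnion, Metric.mem_ball, exists_prop] at this
    exact this
  choose c hct hcd using hcentre
  obtain ⟨L₁, hL₁, L₂, hL₂, hne, hc⟩ := hinf.exists_ne_map_eq_of_mapsTo (f := c) (fun L _ => hct L) htfin
  obtain ⟨g₁, hg₁, rfl⟩ := hL₁
  obtain ⟨g₂, hg₂, rfl⟩ := hL₂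
  refine ⟨g₁⁻¹ * g₂, Γ.mul_mem (Γ.inv_mem hg₁) hg₂, ?_, ?_⟩
  · rw [lin_mul, lin_inv]
    intro h
    apply hne
    simp only at h ⊢
    have := congrArg (fun M => g₁.toRealLinearIsometryEquiv * M) h
    simpa [← mul_assoc] using this.symm
  · have hdist : dist (φ g₁.toRealLinearIsometryEquiv) (φ g₂.toRealLinearIsometryEquiv) < η := by
      calc dist (φ g₁.toRealLinearIsometryEquiv) (φ g₂.toRealLinearIsometryEquiv)
          ≤ dist (φ g₁.toRealLinearIsometryEquiv) (c g₁.toRealLinearIsometryEquiv) +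
            dist (φ g₂.toRealLinearIsometryEquiv) (c g₁.toRealLinearIsometryEquiv) := dist_triangle_right _ _ _
        _ < η / 2 + η / 2 := by
            refine add_lt_add (hcd _) ?_
            simp only at hc
            rw [hc]; exact hcd _
        _ = η := by ring
    rw [dist_eq_norm] at hdist
    have hbound : ∀ x, ‖(g₁⁻¹ * g₂).toRealLinearIsometryEquiv x - x‖ ≤
        ‖φ g₁.toRealLinearIsometryEquiv - φ g₂.toRealLinearIsometryEquiv‖ * ‖x‖ := by
      intro x
      rw [lin_mul, lin_inv]
      set A := g₁.toRealLinearIsometryEquiv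
      set B := g₂.toRealLinearIsometryEquiv
      have h1 : ‖(A⁻¹ * B) x - x‖ = ‖B x - A x‖ := by
        have : (A⁻¹ * B) x - x = A⁻¹ (B x - A x) := by
          rw [map_sub]
          change A.symm (B x) - x = A.symm (B x) - A.symm (A x)
          rw [A.symm_apply_apply]
        rw [this, LinearIsometryEquiv.norm_map]
      rw [h1]
      have h2 : B x - A x = -((φ A - φ B) x) := by simp [hφ]
      rw [h2, norm_neg]
      exact ContinuousLinearMap.le_opNorm _ _
    exact (dev_le_of_bound _ (norm_nonneg _) hbound).trans_lt hdist

/-- **A small nontrivial rotation**: if `Γ` has infinitely many linear parts then for `0 < η ≤ 1`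
there is `g ∈ Γ` whose linear part `A` satisfies `A ≠ 1`, `det A = 1` and `‖A - 1‖ < η`
(square the element of `exists_lin_ne_one_dev_lt`). -/
theorem exists_small_rotation {Γ : Subgroup (EuclideanSpace ℝ (Fin 3) ≃ᵢ EuclideanSpace ℝ (Fin 3))}
    (hinf : ((fun g : EuclideanSpace ℝ (Fin 3) ≃ᵢ EuclideanSpace ℝ (Fin 3) => g.toRealLinearIsometryEquiv) ''
      (Γ : Set (EuclideanSpace ℝ (Fin 3) ≃ᵢ EuclideanSpace ℝ (Fin 3)))).Infinite)
    {η : ℝ} (hη : 0 < η) (hη1 : η ≤ 1) :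
    ∃ g ∈ Γ, g.toRealLinearIsometryEquiv ≠ 1 ∧
      LinearMap.det (g.toRealLinearIsometryEquiv.toLinearEquiv : EuclideanSpace ℝ (Fin 3) →ₗ[ℝ] EuclideanSpace ℝ (Fin 3)) = 1 ∧
      ‖(g.toRealLinearIsometryEquiv.toContinuousLinearEquiv : EuclideanSpace ℝ (Fin 3) →L[ℝ] EuclideanSpace ℝ (Fin 3)) - 1‖ < η := by
  obtain ⟨g, hg, hne, hdev⟩ := exists_lin_ne_one_dev_lt hinf (half_pos hη)
  refine ⟨g * g, Γ.mul_mem hg hg, ?_, ?_, ?_⟩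
  · rw [lin_mul]
    intro h2
    apply hne
    refine eq_one_of_small_of_mul_self (δ := η / 2) (by linarith) (fun x => ?_) h2
    exact (norm_sub_le_dev _ x).trans (mul_le_mul_of_nonneg_right hdev.le (norm_nonneg x))
  · rw [lin_mul]; exact det_mul_self _
  · rw [lin_mul]
    have := dev_mul_self_le g.toRealLinearIsometryEquiv
    linarith

/-! ## Commutator sequences -/

section CommSeq

variable {Γ : Subgroup (EuclideanSpace ℝ (Fin 3) ≃ᵢ EuclideanSpace ℝ (Fin 3))}
  {g h : EuclideanSpace ℝ (Fin 3) ≃ᵢ EuclideanSpace ℝ (Fin 3)}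
  {k : ℕ → (EuclideanSpace ℝ (Fin 3) ≃ᵢ EuclideanSpace ℝ (Fin 3))}

/-- Members of a commutator sequence lie in `Γ`. -/
theorem commSeq_mem (hg : g ∈ Γ) (hh : h ∈ Γ) (hk0 : k 0 = h)
    (hks : ∀ j, k (j + 1) = g * k j * g⁻¹ * (k j)⁻¹) (j : ℕ) : k j ∈ Γ := by
  induction j with
  | zero => rw [hk0]; exact hh
  | succ j ih => rw [hks]; exact Γ.mul_mem (Γ.mul_mem (Γ.mul_mem hg ih) (Γ.inv_mem hg)) (Γ.inv_mem ih)

/-- **Translation part of a commutator**: with `A = L(g)`, `B = L(f)`, `C = L(g f g⁻¹ f⁻¹)`,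
`(g f g⁻¹ f⁻¹) 0 = (A (f 0) - C (f 0)) + (g 0 - (A B A⁻¹) (g 0))`. -/
theorem commutator_apply_zero (g f : EuclideanSpace ℝ (Fin 3) ≃ᵢ EuclideanSpace ℝ (Fin 3)) :
    (g * f * g⁻¹ * f⁻¹) 0 =
      (g.toRealLinearIsometryEquiv (f 0) - (g * f * g⁻¹ * f⁻¹).toRealLinearIsometryEquiv (f 0)) +
      (g 0 - (g.toRealLinearIsometryEquiv * f.toRealLinearIsometryEquiv * g.toRealLinearIsometryEquiv⁻¹) (g 0)) := by
  set A := g.toRealLinearIsometryEquiv with hA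
  set B := f.toRealLinearIsometryEquiv with hB
  have hC : (g * f * g⁻¹ * f⁻¹).toRealLinearIsometryEquiv = A * B * A⁻¹ * B⁻¹ := by
    rw [lin_mul, lin_mul, lin_mul, lin_inv, lin_inv]
  rw [hC, mul_apply_zero, mul_apply_zero, mul_apply_zero, inv_apply_zero, inv_apply_zero, lin_mul, lin_mul,
    lin_inv, ← hA, ← hB]
  simp only [LinearIsometryEquiv.coe_mul, Function.comp_apply, map_neg, LinearIsometryEquiv.coe_inv]
  abel_nf

/-- Norm bound for the translation part of a commutator in terms of deviations:
`‖[g,f] 0‖ ≤ ‖B-1‖ ‖g 0‖ + (‖A-1‖ + ‖C-1‖) ‖f 0‖`. -/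
theorem norm_commutator_apply_zero_le (g f : EuclideanSpace ℝ (Fin 3) ≃ᵢ EuclideanSpace ℝ (Fin 3)) :
    ‖(g * f * g⁻¹ * f⁻¹) 0‖ ≤
      ‖(f.toRealLinearIsometryEquiv.toContinuousLinearEquiv : EuclideanSpace ℝ (Fin 3) →L[ℝ] EuclideanSpace ℝ (Fin 3)) - 1‖ * ‖g 0‖ +
      (‖(g.toRealLinearIsometryEquiv.toContinuousLinearEquiv : EuclideanSpace ℝ (Fin 3) →L[ℝ] EuclideanSpace ℝ (Fin 3)) - 1‖ +
        ‖((g * f * g⁻¹ * f⁻¹).toRealLinearIsometryEquiv.toContinuousLinearEquiv :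
          EuclideanSpace ℝ (Fin 3) →L[ℝ] EuclideanSpace ℝ (Fin 3)) - 1‖) * ‖f 0‖ := by
  rw [commutator_apply_zero]
  set A := g.toRealLinearIsometryEquiv
  set B := f.toRealLinearIsometryEquiv
  set C := (g * f * g⁻¹ * f⁻¹).toRealLinearIsometryEquiv
  have h1 : ‖A (f 0) - C (f 0)‖ ≤
      (‖(A.toContinuousLinearEquiv : EuclideanSpace ℝ (Fin 3) →L[ℝ] EuclideanSpace ℝ (Fin 3)) - 1‖ +
       ‖(C.toContinuousLinearEquiv : EuclideanSpace ℝ (Fin 3) →L[ℝ] EuclideanSpace ℝ (Fin 3)) - 1‖) * ‖f 0‖ := by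
    calc ‖A (f 0) - C (f 0)‖ = ‖(A (f 0) - f 0) - (C (f 0) - f 0)‖ := by congr 1; abel
      _ ≤ ‖A (f 0) - f 0‖ + ‖C (f 0) - f 0‖ := norm_sub_le _ _
      _ ≤ _ := by
        rw [add_mul]
        exact add_le_add (norm_sub_le_dev A _) (norm_sub_le_dev C _)
  have h2 : ‖g 0 - (A * B * A⁻¹) (g 0)‖ ≤
      ‖(B.toContinuousLinearEquiv : EuclideanSpace ℝ (Fin 3) →L[ℝ] EuclideanSpace ℝ (Fin 3)) - 1‖ * ‖g 0‖ := by
    rw [← norm_neg, neg_sub]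
    exact small_conj (norm_sub_le_dev B) (g 0)
  calc ‖A (f 0) - C (f 0) + (g 0 - (A * B * A⁻¹) (g 0))‖
      ≤ ‖A (f 0) - C (f 0)‖ + ‖g 0 - (A * B * A⁻¹) (g 0)‖ := norm_add_le _ _
    _ ≤ _ := by linarith

/-- **The commutator sequence reaches the identity.** Let `Γ` be discontinuous, `g ∈ Γ` with
`‖L(g) - 1‖ ≤ 1/10` whose linear part fixes every translation vector of `Γ`, `h ∈ Γ`, and
`k₀ = h`, `k_{j+1} = g k_j g⁻¹ k_j⁻¹`. Then `k_J = 1` for some `J`. -/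
theorem exists_commSeq_eq_one (hΓ : IsDiscontinuous Γ) (hg : g ∈ Γ) (hh : h ∈ Γ)
    (hsmall : ‖(g.toRealLinearIsometryEquiv.toContinuousLinearEquiv :
      EuclideanSpace ℝ (Fin 3) →L[ℝ] EuclideanSpace ℝ (Fin 3)) - 1‖ ≤ 1 / 10)
    (hfixT : ∀ v ∈ translationVectors Γ, g.toRealLinearIsometryEquiv v = v)
    (hk0 : k 0 = h) (hks : ∀ j, k (j + 1) = g * k j * g⁻¹ * (k j)⁻¹) : ∃ J, k J = 1 := by
  -- deviations `d j` of the linear parts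
  set d : ℕ → ℝ := fun j => ‖((k j).toRealLinearIsometryEquiv.toContinuousLinearEquiv :
    EuclideanSpace ℝ (Fin 3) →L[ℝ] EuclideanSpace ℝ (Fin 3)) - 1‖ with hd
  have hd_nonneg : ∀ j, 0 ≤ d j := fun j => norm_nonneg _
  have hd_succ : ∀ j, d (j + 1) ≤ (1 / 5) * d j := by
    intro j
    have h1 : (k (j + 1)).toRealLinearIsometryEquiv =
        g.toRealLinearIsometryEquiv * (k j).toRealLinearIsometryEquiv * g.toRealLinearIsometryEquiv⁻¹ *
          ((k j).toRealLinearIsometryEquiv)⁻¹ := by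
      rw [hks, lin_mul, lin_mul, lin_mul, lin_inv, lin_inv]
    simp only [hd]
    rw [h1]
    have := dev_commutator_le g.toRealLinearIsometryEquiv (k j).toRealLinearIsometryEquiv
    have hdj := hd_nonneg j
    simp only [hd] at hdj
    nlinarith
  have hd_le_two : ∀ j, d j ≤ 2 := fun j => dev_le_two _
  have hd_succ_le : ∀ j, d (j + 1) ≤ 2 / 5 := fun j => by
    have := hd_succ j; have := hd_le_two j; linarith
  -- translation parts stay bounded by `M`
  set M : ℝ := max ‖h 0‖ (4 * ‖g 0‖) with hM
  have hb : ∀ j, ‖k j 0‖ ≤ M := by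
    intro j
    induction j with
    | zero => rw [hk0]; exact le_max_left _ _
    | succ j ih =>
      rw [hks]
      have h1 := norm_commutator_apply_zero_le g (k j)
      rw [← hks] at h1
      have hdj : d j ≤ 2 := hd_le_two j
      have hdj1 : d (j + 1) ≤ 2 / 5 := hd_succ_le j
      simp only [hd] at hdj hdj1
      have hg0 := norm_nonneg (g 0)
      have hk0' := norm_nonneg (k j 0)
      have h4 : 4 * ‖g 0‖ ≤ M := le_max_right _ _
      rw [← hks]
      nlinarith
  -- hence the sequence takes values in a finite set and repeats
  have hfin := finite_setOf_norm_apply_zero_le hΓ M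
  obtain ⟨j₁, j₂, hlt, heq⟩ := hfin.exists_lt_map_eq_of_forall_mem (f := k)
    (fun j => (⟨commSeq_mem hg hh hk0 hks j, hb j⟩ : k j ∈ Γ ∧ ‖k j 0‖ ≤ M))
  -- a repetition forces a vanishing deviation
  have hiter : ∀ n, d (j₁ + n) ≤ (1 / 5) ^ n * d j₁ := by
    intro n
    induction n with
    | zero => simp
    | succ n ih =>
      rw [← add_assoc, pow_succ]
      have := hd_succ (j₁ + n)
      have h5 : (0 : ℝ) ≤ (1 / 5) ^ n := by positivity
      nlinarith
  have hdeq : d j₂ = d j₁ := by simp only [hd, heq]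
  obtain ⟨n, rfl⟩ := Nat.exists_eq_add_of_lt hlt
  have hn := hiter (n + 1)
  rw [show j₁ + n + 1 = j₁ + (n + 1) by ring] at hdeq
  rw [hdeq] at hn
  have hpow : ((1 : ℝ) / 5) ^ (n + 1) ≤ 1 / 5 := by
    rw [pow_succ]
    have : ((1 : ℝ) / 5) ^ n ≤ 1 := pow_le_one₀ (by norm_num) (by norm_num)
    nlinarith
  have hd0 : d j₁ = 0 := by
    have := hd_nonneg j₁
    nlinarith
  -- so `k j₁` is a translation of `Γ`, commuting with `g`, and the next term is `1`
  have hlin1 : (k j₁).toRealLinearIsometryEquiv = 1 := eq_one_of_dev_eq_zero _ hd0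
  obtain ⟨v, hv, hkv⟩ : ∃ v ∈ translationVectors Γ, k j₁ = IsometryEquiv.addRight v := by
    refine ⟨k j₁ 0, ?_, eq_addRight_of_lin_eq_one hlin1⟩
    rw [mem_translationVectors_iff, ← eq_addRight_of_lin_eq_one hlin1]
    exact commSeq_mem hg hh hk0 hks j₁
  refine ⟨j₁ + 1, ?_⟩
  rw [hks, hkv, conj_addRight, hfixT v hv, mul_inv_cancel]

/-- **Downward induction along a commutator sequence.** If `k_J = 1`, a property `Q` holds for
every `f` commuting with `g`, and `Q (k_{j+1}) → Q (k_j)` for all `j`, then `Q (k_0)`. -/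
theorem commSeq_downward {Q : (EuclideanSpace ℝ (Fin 3) ≃ᵢ EuclideanSpace ℝ (Fin 3)) → Prop}
    (hks : ∀ j, k (j + 1) = g * k j * g⁻¹ * (k j)⁻¹) {J : ℕ} (hJ : k J = 1)
    (hbase : ∀ f, g * f = f * g → Q f) (hstep : ∀ j, Q (k (j + 1)) → Q (k j)) : Q (k 0) := by
  -- first, `Q (k j)` for some `j` from commutation
  have hex : ∃ j, Q (k j) := by
    cases J with
    | zero => exact ⟨0, by rw [hJ]; exact hbase 1 (by rw [mul_one, one_mul])⟩
    | succ J' =>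
      refine ⟨J', hbase _ ?_⟩
      have h1 := hks J'
      rw [hJ] at h1
      -- `1 = g k g⁻¹ k⁻¹` ⇒ `g k = k g`
      have h2 : g * k J' * g⁻¹ * (k J')⁻¹ * (k J') * g = 1 * (k J') * g := by rw [← h1]
      simp only [one_mul, mul_assoc, inv_mul_cancel, mul_one] at h2
      simpa [mul_assoc] using h2
  obtain ⟨j, hj⟩ := hex
  -- then go down
  induction j with
  | zero => exact hj
  | succ j ih => exact ih (hstep j hj)

end CommSeq

/-- Anchor (registered sub-goal of `stub_groupStructure`): **a small nontrivial rotation from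
infinitely many linear parts**, in closed form (`η = 1/10`). -/
theorem groupStructure_exists_small_rotation : ∀ Γ : Subgroup (EuclideanSpace ℝ (Fin 3) ≃ᵢ EuclideanSpace ℝ (Fin 3)), ((fun g : EuclideanSpace ℝ (Fin 3) ≃ᵢ EuclideanSpace ℝ (Fin 3) => g.toRealLinearIsometryEquiv) '' (Γ : Set (EuclideanSpace ℝ (Fin 3) ≃ᵢ EuclideanSpace ℝ (Fin 3)))).Infinite → ∃ g ∈ Γ, g.toRealLinearIsometryEquiv ≠ 1 ∧ LinearMap.det (g.toRealLinearIsometryEquiv.toLinearEquiv : EuclideanSpace ℝ (Fin 3) →ₗ[ℝ] EuclideanSpace ℝ (Fin 3)) = 1 ∧ ‖(g.toRealLinearIsometryEquiv.toContinuousLinearEquiv : EuclideanSpace ℝ (Fin 3) →L[ℝ] EuclideanSpace ℝ (Fin 3)) - 1‖ < 1 / 10 := by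
  intro Γ hinf
  exact exists_small_rotation hinf (by norm_num) (by norm_num)

end Summit.AtomisticToContinuum.Crystallization.Theorems.IsometryAtomsMinimisingLawsCohesive.GroupStructure

end
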